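import Literature.AlgebraicTopology.SingularHomology.TorusCoordinateClasses
import Literature.Geometry.Kaehler.ComplexTorusHomLift
import HarnessLib

/-!
# `H¹` of a complex torus under the homomorphism of an integer matrix: the transpose

H. Lange, Ch. Birkenhake, *Complex Abelian Varieties* (1992), §1.1.2 (rational representation
`ρᵣ(f) = A ∈ M(ι' × ι; ℤ)` of a homomorphism `f : E/Λ → E'/Λ'` in lattice coordinates) and §1.1.3
(`H¹(X; ℤ) = Hom(Λ, ℤ)`), eq. (1.2); A. Hatcher, *Algebraic Topology* (2002), §3.2 Example 3.16.
For the tree's complex tori `ComplexTorus Φ = E/Φ(ℤ^ι)` (underlying real torus `ι → ℝ/ℤ`,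
`Literature/Geometry/Kaehler/ComplexTorus.lean`) and the homomorphism
`ComplexTorus.mapMatrix Φ Φ' A : x ↦ (i' ↦ Σᵢ A i' i • xᵢ)` of an integer matrix `A`
(`ComplexTorusMaps.lean`), the induced map on `H¹(−; R)` is the TRANSPOSE of `A` in the coordinate
classes `ξᵢ = pᵢ^* θ` (`pᵢ` the `i`-th coordinate `E/Φ(ℤ^ι) → ℝ/ℤ`, `θ` the integral generator of
`H¹(ℝ/ℤ)`): **`(mapMatrix A)^* ξ'_{i'} = Σᵢ A i' i • ξᵢ`**, for every commutative ring `R` — the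
specialisation of `map_eval_circleClass_of_matrix` (`Literature/AlgebraicTopology/SingularHomology/TorusCoordinateClasses.lean`,
pure topology: additivity of `θ`-pull-backs, Hatcher §3.C Exercise 11; for `Fin`-indexed tori the
tree's `map_torusMap_torusXi`) to `mapMatrix`, over every field `F` and over every commutative ring
`R : Type` (e.g. `ℤ`). No de Rham theory is used, so the
statement is available for tori of DIFFERENT dimensions / model spaces `E ≠ E'`.

* `ComplexTorus.coord Φ i` is not introduced: the coordinate projection is written
  `(ContinuousMap.eval i).comp (toRealTorus Φ)` (`toRealTorus` is the identity homeomorphism);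
* `ComplexTorus.mapMatrixCM` is not introduced either: the continuous map is the anonymous
  `⟨mapMatrix Φ Φ' A, continuous_mapMatrix A⟩` (`continuous_mapMatrix` of `ComplexTorusHomLift.lean`).

Everything is proved; no named facts. Consumer: the `H¹`-naturality step (δ) of Riemann's theorem
(Deligne–Milne, LNM 900, II Thm. 6.20) for `Motives.AbelianVariety ℂ`, assembled in
`Literature/AlgebraicGeometry/HodgeTheory` (cell pub-hodgecm2, LIT-FANOUT row D1).

## References

* H. Lange, Ch. Birkenhake, *Complex Abelian Varieties*, Grundlehren 302, Springer 1992, §1.1.2,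
  §1.1.3, eq. (1.2). [LangeBirkenhake1992]
* A. Hatcher, *Algebraic Topology*, CUP 2002, §3.2 Example 3.16. [HatcherAT2002]
-/

noncomputable section

open CategoryTheory

universe v
open Literature.AlgebraicTopology.SingularHomology

namespace Literature.Geometry.Kaehler

namespace ComplexTorus

variable {ι ι' : Type} [Fintype ι] [Fintype ι']
  {E E' : Type*} [NormedAddCommGroup E] [NormedSpace ℂ E] [NormedAddCommGroup E'] [NormedSpace ℂ E']
  (Φ : (ι → ℝ) ≃L[ℝ] E) (Φ' : (ι' → ℝ) ≃L[ℝ] E')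

omit [Fintype ι'] in
/-- **`(mapMatrix A)^* ξ'_{i'} = Σᵢ A i' i • ξᵢ` in `H¹(E/Φ(ℤ^ι); F)`**, `F` a field: on the
coordinate classes `ξᵢ = pᵢ^* θ` the homomorphism of complex tori given by the integer matrix `A`
(its rational representation) acts on `H¹` by the transpose of `A`.
[cite: LangeBirkenhake1992, §1.1.2, §1.1.3, eq. (1.2)] [cite: HatcherAT2002, §3.C Exercise 11] -/
theorem map_mapMatrix_eval_circleClass
    (F : Type v) [Field F] (A : Matrix ι' ι ℤ) (i' : ι') :
    singularCohomology.map F F (⟨mapMatrix Φ Φ' A, continuous_mapMatrix (Φ := Φ) (Φ' := Φ') A⟩ :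
        C(ComplexTorus Φ, ComplexTorus Φ')) 1
        (singularCohomology.map F F ((ContinuousMap.eval i').comp (toRealTorus Φ' : C(ComplexTorus Φ', ι' → AddCircle (1 : ℝ)))) 1
          (circleClass F)) =
      ∑ i, (A i' i : F) •
        singularCohomology.map F F ((ContinuousMap.eval i).comp (toRealTorus Φ : C(ComplexTorus Φ, ι → AddCircle (1 : ℝ)))) 1
          (circleClass F) :=
  map_eval_circleClass_of_matrix F A ⟨mapMatrix Φ Φ' A, continuous_mapMatrix (Φ := Φ) (Φ' := Φ') A⟩ (fun _ _ => rfl) i'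

/-- **Coordinate-vector form**: `(mapMatrix A)^* (Σ_{i'} c_{i'} • ξ'_{i'}) = Σᵢ (Aᵀ c)ᵢ • ξᵢ` for
`c : ι' → F`, i.e. `H¹(mapMatrix A)` is the matrix `Aᵀ` on coordinate vectors (the coordinate classes
form a basis of `H¹(−; F)`: `linearIndependent_eval_circleClass`, `span_eval_circleClass_eq_top`).
[cite: LangeBirkenhake1992, §1.1.2, eq. (1.2)] -/
theorem map_mapMatrix_sum_smul_eval_circleClass
    (F : Type v) [Field F] (A : Matrix ι' ι ℤ) (c : ι' → F) :
    singularCohomology.map F F (⟨mapMatrix Φ Φ' A, continuous_mapMatrix (Φ := Φ) (Φ' := Φ') A⟩ :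
        C(ComplexTorus Φ, ComplexTorus Φ')) 1
        (∑ i', c i' • (singularCohomology.map F F
          ((ContinuousMap.eval i').comp (toRealTorus Φ' : C(ComplexTorus Φ', ι' → AddCircle (1 : ℝ)))) 1
          (circleClass F) : singularCohomology F F (ComplexTorus Φ') 1)) =
      ∑ i, ((A.map (Int.cast : ℤ → F)).transpose.mulVec c) i •
        (singularCohomology.map F F
          ((ContinuousMap.eval i).comp (toRealTorus Φ : C(ComplexTorus Φ, ι → AddCircle (1 : ℝ)))) 1
          (circleClass F) : singularCohomology F F (ComplexTorus Φ) 1) :=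
  map_sum_smul_eval_circleClass_of_matrix F A ⟨mapMatrix Φ Φ' A, continuous_mapMatrix (Φ := Φ) (Φ' := Φ') A⟩
    (fun _ _ => rfl) c

omit [Fintype ι'] in
/-- **Integral coefficients** (and every commutative ring `R : Type`):
`(mapMatrix A)^* ξ'_{i'} = Σᵢ A i' i • ξᵢ` in `H¹(E/Φ(ℤ^ι); R)` — Lange–Birkenhake's
`H¹(f; ℤ) = ᵗρᵣ(f)` on `H¹(X; ℤ) = Hom(Λ, ℤ)`. [cite: LangeBirkenhake1992, §1.1.3, eq. (1.2)] -/
theorem map_mapMatrix_eval_circleClass_of_commRing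
    (R : Type) [CommRing R] (A : Matrix ι' ι ℤ) (i' : ι') :
    singularCohomology.map R R (⟨mapMatrix Φ Φ' A, continuous_mapMatrix (Φ := Φ) (Φ' := Φ') A⟩ :
        C(ComplexTorus Φ, ComplexTorus Φ')) 1
        (singularCohomology.map R R ((ContinuousMap.eval i').comp (toRealTorus Φ' : C(ComplexTorus Φ', ι' → AddCircle (1 : ℝ)))) 1
          (circleClass R)) =
      ∑ i, (A i' i : R) •
        singularCohomology.map R R ((ContinuousMap.eval i).comp (toRealTorus Φ : C(ComplexTorus Φ, ι → AddCircle (1 : ℝ)))) 1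
          (circleClass R) :=
  map_eval_circleClass_of_matrix_of_commRing R A ⟨mapMatrix Φ Φ' A, continuous_mapMatrix (Φ := Φ) (Φ' := Φ') A⟩
    (fun _ _ => rfl) i'

end ComplexTorus

end Literature.Geometry.Kaehler

end
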